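import Summits.BirchSwinnertonDyer.BirchSwinnertonDyer.Theorems.GoldfeldAllTwistsTwoConverseTwinEvenTwistSelmerPOne
import Summits.BirchSwinnertonDyer.BirchSwinnertonDyer.Theorems.GoldfeldAllTwistsTwoConverseTwinQuarterTracePartnerQHeight
import HarnessLib

set_option linter.dupNamespace false -- namespace `…BirchSwinnertonDyer.BirchSwinnertonDyer…` is the cell's (D-0017 nested layout)
set_option autoImplicit false

/-!
# Cell C7 (β, `p ≡ 1 (mod 8)`), file F2 = (M7b): the `L`-value DICHOTOMY of the even partner —
# `L(49a1^{(2p)}, 1) = q·Ω_∞` with `q = 0` or `ord₂ q ≥ 4` (Burungale–Flach + the Selmer lower bound of F1)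

Cell `bsd-goldfeld`, seat `bsd-goldfeld-s1p-c3x` (gen 12); planner ORDER «C7-SCOPING» (RULING (cccxxvi)), memo `HOME/C7-HORIZON.md` §2 (M7b) / §4 F2.
`--supports stmt-BirchSwinnertonDyer-20044` as a HELPER (planner RULING (cccxxxviii), TRANCHE C7-1). Theses-free; theorems only; no definition, no `sorry`; named-fact BINDERS, both in the
cell's standing allowlist and consumed BY NAME: `hBF = bsdTriple_of_hasCM_of_L_one_ne_zero` (Burungale–Flach, full BSD for CM curves of analytic
rank `0`), `hnew = exists_isNewformOf` (modularity dictionary). NO Burungale–Tian (`hBT`) on C7. NO new fact.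

OBJECT. For a prime `p ≡ 1 (mod 8)` with `(−7/p) = +1` and `−7` a fourth power mod `p` (type β; cell C7) and every GLOBALLY MINIMAL model `W'` of
`49a1^{(2p)}`: **`exists_LAlg_twoPosTwist_pOne`** — `L(W', 1) = q·Ω_∞(W')` with `q ∈ ℚ` and EITHER `q = 0` OR `q ≠ 0 ∧ ord₂ q ≥ 4`. Indeed if
`L(W',1) ≠ 0`, Burungale–Flach gives rank `0`, `Ш` finite and `q = #Ш·Tam/#W'(ℚ)² = 8·#Ш` (`Tam = 32`, `#W'(ℚ) = 2`, LINE C3's factors, `p` odd);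
and F1 (`exists_mem_sha_two_twoPosTwist_pOne`: `(#S, #S')(49a1^{(2p)}) ⊇ (·, 4)` on C7) puts an element of order `2` in `Ш(W')`, so `#Ш` is EVEN and
`ord₂ q ≥ 4`. (On C4/C6/C8, `p ≡ 5 (mod 8)`, LINE C3 proved `ord₂ q = 3` EXACTLY; this is the flipped bit (M7) of the C7 line: it makes the `χ_q`
multiplier `m` EVEN in the quarter-trace bookkeeping.) `lValue_twoPosTwist_mul_sqrt_pOne` rewrites it as `L(W₂,1)·√(8p) = r·Ω(X₀(49))`,
`r = 0 ∨ ord₂ r ≥ 4`, through the landed `p`-odd period law `Ω(W₂)·√(8p) = Ω(49a1)`.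

NUMERICS (kit j312848 + j312976/j313281, PARI 2.17.3; evidence on item 19140): on all 70 C7 rows with `qp ≤ 150000`, `r_an(49a1^{(2p)}) = 0` with
`ord₂(L/Ω) ∈ {5, 7, 9}` (never `3`, never `4`) or `r_an = 2`. FALSIFIER = a C7 prime `p` with `ord₂ L^{alg}(49a1^{(2p)},1) ≤ 3`.
HONEST FRAMING: CONDITIONAL on the two named facts; a statement about the even partner; no Heegner point; no case of K12₂″ / twin″ decided;
BSD is not proved by any of this.

References: Burungale–Flach, Camb. J. Math. 12 (2024) Thm 1.1, Cor. 2 [BurungaleFlach2024]; Coates–Li–Tian–Zhai, PLMS 110 (2015) Prop. 5.9 (shape)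
[CoatesLiTianZhai2015]; Pal, JNT 132 (2012) Thm 3.2 [Pal2012]; Silverman, *AEC* X.4 [SilvermanAEC2009].
-/

noncomputable section

open scoped Classical

open WeierstrassCurve Literature.NumberTheory.EllipticCurves Literature.NumberTheory.EllipticCurves.ModularForms
  Literature.NumberTheory.EllipticCurves.Rank1Residual Summit.BirchSwinnertonDyer.Rank1Residual.P2
  Literature.NumberTheory.EllipticCurves.CoatesLiTianZhai2015

namespace Summit.BirchSwinnertonDyer.BirchSwinnertonDyer.Theorems.GoldfeldGoodTwists

variable {p : ℕ} [Fact p.Prime]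

/-- `2 ∣ #Ш(W')` when `Ш(W')` is finite and has a non-zero class killed by `2`. [folklore] -/
theorem two_dvd_shaOrder_of_exists_mem {W' : WeierstrassCurve ℚ} [W'.IsElliptic] [Finite W'.sha]
    (h : ∃ c ∈ W'.sha, c ≠ 0 ∧ 2 • c = 0) : 2 ∣ W'.shaOrder := by
  obtain ⟨c, hc, hc0, hc2⟩ := h
  have horder : addOrderOf (⟨c, hc⟩ : W'.sha) = 2 := by
    refine (addOrderOf_eq_prime ?_ ?_)
    · exact Subtype.ext (by simpa using hc2)
    · exact fun h ↦ hc0 (congrArg Subtype.val h)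
  rw [WeierstrassCurve.shaOrder, ← horder]
  exact addOrderOf_dvd_natCard _

/-- **THE EVEN-PARTNER `L`-VALUE ON C7: `L(W',1) = q·Ω_∞(W')`, `q = 0 ∨ (q ≠ 0 ∧ ord₂ q ≥ 4)`** for every globally minimal model `W'` of
`49a1^{(2p)}`, `p ≡ 1 (mod 8)` prime with `(−7/p) = +1` of type β — granted Burungale–Flach (`hBF`) and modularity (`hnew`); `q = 8·#Ш` with `#Ш`
EVEN by F1 when `L(W',1) ≠ 0`. [cite: BurungaleFlach2024, Thm. 1.1 and Cor. 2] [cite: CoatesLiTianZhai2015, Prop. 5.9 (shape)] [cite: SilvermanAEC2009, Thm. X.4.2(a)] -/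
theorem exists_LAlg_twoPosTwist_pOne (hBF : bsdTriple_of_hasCM_of_L_one_ne_zero) (hnew : exists_isNewformOf)
    (hp8 : p % 8 = 1) (hp7 : legendreSym p (-7) = 1) (hβ : ∃ x : ZMod p, x ^ 4 = -7)
    (W' : WeierstrassCurve ℚ) [W'.IsElliptic] [W'.IsGloballyMinimal]
    (hC : ∃ C : VariableChange ℚ, C • W' = cm7.quadraticTwist ((2 * (p : ℤ) : ℤ) : ℚ)) :
    ∃ q : ℚ, W'.entireLFunction 1 = ((q * CoatesLiTianZhai2015.leastRealPeriod W' : ℝ) : ℂ) ∧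
      (q = 0 ∨ (q ≠ 0 ∧ 4 ≤ padicValRat 2 q)) := by
  have hp : p.Prime := Fact.out
  obtain ⟨hp2, -, hp7ne, -⟩ := aux_of_mod_eight_one hp8
  obtain ⟨C, hC⟩ := hC
  have hd0 : (2 * (p : ℤ) : ℤ) ≠ 0 := mul_ne_zero two_ne_zero (by exact_mod_cast hp.ne_zero)
  have hdQ : (((2 * (p : ℤ) : ℤ)) : ℚ) ≠ 0 := by exact_mod_cast hd0
  haveI : Fact (Nat.Prime 2) := ⟨Nat.prime_two⟩
  by_cases hL : W'.entireLFunction 1 = 0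
  · exact ⟨0, by rw [hL]; push_cast; ring, Or.inl rfl⟩
  have hmod : hasEntireLFunction_rat := hasEntireLFunction_rat_of_exists_isNewformOf hnew
  obtain ⟨hj, hcm, -⟩ := minimalModel_quadraticTwist_cm7 hd0 W' C hC
  ------------------------------------------------------------------ Burungale–Flach: rank `0`, `Ш` finite, `L(1)/Ω = #Ш·Tam/#W'(ℚ)²`
  obtain ⟨hfinpt, hfin, hq⟩ := twin_centralValue_eq_of_hasCM hBF hmod W' hcm hL
  haveI := hfinpt; haveI := hfin
  obtain ⟨hrank, -, -⟩ := hBF W' hcm hL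
  have hr0 : W'.analyticRank = 0 := (W'.analyticRank_eq_zero_iff_holds (hmod W')).mpr hL
  have hrk : W'.mordellWeilRank = 0 := by rw [← hrank, hr0]
  ------------------------------------------------------------------ the three arithmetic factors; `#Ш` EVEN (F1)
  have hjac : jacobiSym p 7 = 1 := by rw [← legendreSym_neg_seven_eq_jacobiSym hp2]; exact hp7
  have htam : W'.tamagawaProduct = 32 := tamagawaProduct_eq_thirtytwo_twoPosTwist hp2 hp7ne hjac W' C hC
  have hcard : Nat.card W'.toAffine.Point = 2 := by
    rw [← torsionOrder_eq_natCard_of_finite]; exact torsionOrder_eq_two_of_j_eq W' (Or.inl hj)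
  have hS0 : W'.shaOrder ≠ 0 := (Nat.card_pos (α := W'.sha)).ne'
  have hsha : 1 ≤ padicValNat 2 W'.shaOrder := by
    have h2 := two_dvd_shaOrder_of_exists_mem (exists_mem_sha_two_twoPosTwist_pOne hp8 hp7 hβ W' C hC hrk)
    exact (padicValNat_dvd_iff_le hS0).mp (by simpa using h2)
  ------------------------------------------------------------------ the witness `q = twinQuotient W' = 8·#Ш`
  have hΩ : CoatesLiTianZhai2015.leastRealPeriod W' = W'.realPeriodRat :=
    leastRealPeriod_eq_realPeriodRat_of_smul_eq_cm7_quadraticTwist W' hdQ ⟨C, hC⟩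
  have hΩ0 : (W'.realPeriodRat : ℂ) ≠ 0 := by exact_mod_cast (W'.realPeriodRat_pos_holds).ne'
  have htq : twinQuotient W' = 8 * (W'.shaOrder : ℚ) := by
    unfold twinQuotient; rw [htam, hcard]; push_cast; ring
  refine ⟨twinQuotient W', ?_, Or.inr ⟨?_, ?_⟩⟩
  · rw [hΩ]; push_cast
    rw [← hq]; field_simp
  · rw [htq]; exact mul_ne_zero (by norm_num) (by exact_mod_cast hS0)
  · have h8 : padicValRat 2 (8 : ℚ) = 3 := by
      rw [show (8 : ℚ) = ((8 : ℕ) : ℚ) by norm_num, padicValRat.of_nat]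
      norm_cast
      rw [show (8 : ℕ) = 2 ^ 3 by norm_num, padicValNat.prime_pow]
    rw [htq, padicValRat.mul (by norm_num) (by exact_mod_cast hS0), padicValRat.of_nat, h8]
    have : (1 : ℤ) ≤ (padicValNat 2 W'.shaOrder : ℤ) := by exact_mod_cast hsha
    omega

/-- **`L(W₂, 1)·√(8p) = r·Ω(X₀(49))` with `r = 0 ∨ ord₂ r ≥ 4`**, for every globally minimal `W₂ ≅ 49a1^{(2p)}` on C7: `exists_LAlg_twoPosTwist_pOne`,
`Ω_∞ = Ω` (one real component) and the landed `p`-odd period law `Ω(W₂)·√(8p) = Ω(49a1)` (`realPeriodRat_mul_sqrt_eight_mul_of_smul_eq_cm7_quadraticTwist_twoPos`).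
[cite: BurungaleFlach2024, Thm. 1.1] [cite: Pal2012, Thm. 3.2] -/
theorem lValue_twoPosTwist_mul_sqrt_pOne (hBF : bsdTriple_of_hasCM_of_L_one_ne_zero) (hnew : exists_isNewformOf)
    (hp8 : p % 8 = 1) (hp7 : legendreSym p (-7) = 1) (hβ : ∃ x : ZMod p, x ^ 4 = -7)
    (W₂ : WeierstrassCurve ℚ) [W₂.IsElliptic] [W₂.IsGloballyMinimal]
    (hC : ∃ C : VariableChange ℚ, C • W₂ = cm7.quadraticTwist ((2 * (p : ℤ) : ℤ) : ℚ)) :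
    ∃ r : ℚ, (r = 0 ∨ 4 ≤ padicValRat 2 r) ∧
      W₂.entireLFunction 1 * (Real.sqrt (8 * p) : ℂ) = ((r : ℝ) * cm7.realPeriodRat : ℝ) := by
  have hp : p.Prime := Fact.out
  obtain ⟨hp2, -, -, -⟩ := aux_of_mod_eight_one hp8
  have hdQ : (((2 * (p : ℤ) : ℤ)) : ℚ) ≠ 0 := by
    push_cast; exact mul_ne_zero two_ne_zero (by exact_mod_cast hp.ne_zero)
  obtain ⟨r, hL, hr⟩ := exists_LAlg_twoPosTwist_pOne hBF hnew hp8 hp7 hβ W₂ hC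
  refine ⟨r, ?_, ?_⟩
  · rcases hr with h | ⟨-, h⟩
    · exact Or.inl h
    · exact Or.inr h
  · rw [hL, leastRealPeriod_eq_realPeriodRat_of_smul_eq_cm7_quadraticTwist W₂ hdQ hC,
      ← realPeriodRat_mul_sqrt_eight_mul_of_smul_eq_cm7_quadraticTwist_twoPos hp2 W₂ hC]
    push_cast
    ring

end Summit.BirchSwinnertonDyer.BirchSwinnertonDyer.Theorems.GoldfeldGoodTwists

end
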